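import Summits.ValiantsHypothesis.ValiantsHypothesis.Theorems.LacunarySymmetroidMatrixDescartesKernelDefiniteJunctionSeamArray
import Summits.ValiantsHypothesis.ValiantsHypothesis.Theorems.LacunarySymmetroidMatrixDescartesKernelDefiniteJunctionSeamCoeff

/-!
# Kernel-definite junction, part 8e: the seam datum (constraint, corner coefficients, fewnomial edge)

Helper file for the stub `stub_kernelDefiniteJunction` of the line `junction_ceiling` (crux `MatrixDescartes`,
stmt-ValiantsHypothesis-18050).  From the seam limit on the coefficient array (8c) and the coefficient reader (8b):
for the junction with diagonalised junction letter `J = U diag(λ) Uᵀ`, `w = e 1 − e 0`, `g = d last − d last'`,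
`n₀ = ∑_i (λ_i = 0 ? ã' : ã)`, `c = #{λ_i = 0}`, `D = ∏_{λ ≠ 0} λ_i`, `φ(s) = det (A' + s B')`:
* `seam_constraint` — `F i j ≠ 0 ⇒ w i ≤ w n₀ + g j` (the Newton-chain seam constraint);
* `seam_coeff` — on the seam line `w i = w n₀ + g j`: `F i j = [w ∣ j] φ_{j/w} · D`;
* `n0_add_gc` — `n₀ + g c = m ã`; `natDegree_phi_le`, `coeff_phi_zero`, `coeff_phi_top`;
* `card_support_seamEdge_le` — the seam edge polynomial `E₂` has at most `c + 1` monomials.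
[folklore]
-/

-- `Summit.ValiantsHypothesis.ValiantsHypothesis.…` is the tree's mandated single-conjunct layout (Sub = Summit).
set_option linter.dupNamespace false
set_option autoImplicit false

namespace Summit.ValiantsHypothesis.ValiantsHypothesis.Theorems.LacunarySymmetroidMatrixDescartes.JunctionCeiling

open Polynomial Finset Matrix Filter Topology
open scoped BigOperators

/-! ## 1. The compression pencil `φ` -/

section Phi

variable {n : Type*} [Fintype n] [DecidableEq n] (A B : Matrix n n ℝ)

/-- `deg φ ≤ #n`. [folklore] -/
theorem natDegree_phi_le : (det (Matrix.of fun i k : n => C (A i k) + X * C (B i k))).natDegree ≤ Fintype.card n := by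
  have h := Literature.LinearAlgebra.Matrix.natDegree_det_le_of_forall_le
    (Matrix.of fun i k : n => C (A i k) + X * C (B i k)) (D := 1) (fun i k => by
      rw [Matrix.of_apply]
      exact (natDegree_add_le _ _).trans (max_le (by simp) (natDegree_mul_le.trans (by simp))))
  simpa using h

/-- `φ(0)`-coefficient `= det A`. [folklore] -/
theorem coeff_phi_zero : (det (Matrix.of fun i k : n => C (A i k) + X * C (B i k))).coeff 0 = det A := by
  rw [coeff_zero_eq_eval_zero, eval_det_affine, zero_smul, add_zero]

/-- top coefficient `[s^{#n}] φ = det B`. [folklore] -/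
theorem coeff_phi_top : (det (Matrix.of fun i k : n => C (A i k) + X * C (B i k))).coeff (Fintype.card n) = det B := by
  have h := Literature.AlgebraicGeometry.DeterminantalHypersurfaces.coeff_det_of_natDegree_le
    (Matrix.of fun i k : n => C (A i k) + X * C (B i k)) 1 (fun i k => by
      rw [Matrix.of_apply]
      exact (natDegree_add_le _ _).trans (max_le (by simp) (natDegree_mul_le.trans (by simp))))
  rw [mul_one] at h
  rw [h]
  congr 1
  ext i k
  rw [Matrix.map_apply, Matrix.of_apply, coeff_add, coeff_C, if_neg one_ne_zero, zero_add,
    show (X : ℝ[X]) * C (B i k) = C (B i k) * X ^ 1 by rw [pow_one, mul_comm], coeff_C_mul_X_pow, if_pos rfl]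

end Phi

/-! ## 2. The seam datum of the junction -/

section Seam

variable {m : ℕ} (K₁ K₂ : ℕ) (d : Fin (K₁ + 2) → ℕ) (S : Fin (K₁ + 2) → Matrix (Fin m) (Fin m) ℝ)
  (e : Fin (K₂ + 2) → ℕ) (T : Fin (K₂ + 2) → Matrix (Fin m) (Fin m) ℝ)
  (H : Matrix (Fin m) (Fin m) (Polynomial ℝ[X]))
  (hH : ∀ i k, H i k = (∑ l : Fin (K₁ + 2), C (C (S l i k)) * X ^ (d l - d 0)) +
    ∑ l : Fin (K₂ + 1), C (C (T l.succ i k) * X ^ (e l.succ - e 0)) * X ^ (d (Fin.last (K₁ + 1)) - d 0))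
  (U : Matrix (Fin m) (Fin m) ℝ) (lam : Fin m → ℝ)
  (hd : StrictMono d) (he : StrictMono e) (hU : U * Uᵀ = 1) (hJ : S (Fin.last (K₁ + 1)) = U * diagonal lam * Uᵀ)

include hH hd he hU hJ

/-- **the seam constraint**: `F i j ≠ 0 ⇒ w i ≤ w n₀ + g j`. [folklore] -/
theorem seam_constraint (i j : ℕ) (hne : ((det H).coeff i).coeff j ≠ 0) :
    (e 1 - e 0) * i ≤ (e 1 - e 0) * (∑ i, (if lam i = 0 then d (Fin.last K₁).castSucc - d 0
        else d (Fin.last (K₁ + 1)) - d 0)) + (d (Fin.last (K₁ + 1)) - d (Fin.last K₁).castSucc) * j := by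
  set w : ℕ := e 1 - e 0 with hw
  set g : ℕ := d (Fin.last (K₁ + 1)) - d (Fin.last K₁).castSucc with hg
  set n₀ : ℕ := ∑ i, (if lam i = 0 then d (Fin.last K₁).castSucc - d 0 else d (Fin.last (K₁ + 1)) - d 0) with hn₀
  set I : ℕ := m * (d (Fin.last (K₁ + 1)) - d 0) with hI
  set J : ℕ := m * (e (Fin.last (K₂ + 1)) - e 0) with hJdef
  have hw0 : 0 < w := Nat.sub_pos_of_lt (he Fin.zero_lt_one)
  by_contra hlt
  push Not at hlt
  apply hne
  by_cases hi : i ≤ I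
  · by_cases hj : j ≤ J
    · have hlim := seam_limit_F K₁ K₂ d S e T H hH U lam hd he hU hJ
      refine coeff_vanish_of_scaling_limit (fun i j => ((det H).coeff i).coeff j) I J w g (w * n₀ + g * J) _ hlim
        hw0 i j hi hj ?_
      have hsplit : g * J = g * j + g * (J - j) := by rw [← mul_add, Nat.add_sub_cancel' hj]
      calc w * n₀ + g * J = (w * n₀ + g * j) + g * (J - j) := by rw [hsplit]; ring
        _ < w * i + g * (J - j) := Nat.add_lt_add_right hlt _
    · exact coeff_eq_zero_of_natDegree_lt
        (lt_of_le_of_lt (natDegree_coeff_G_le (K₁ + 1) (K₂ + 1) d S e T H hH he.monotone i) (lt_of_not_ge hj))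
  · rw [coeff_eq_zero_of_natDegree_lt
      (lt_of_le_of_lt (natDegree_G_le (K₁ + 1) (K₂ + 1) d S e T H hH hd.monotone) (lt_of_not_ge hi)), coeff_zero]

/-- **coefficients on the seam line**: `F i j = [w ∣ j] φ_{j/w} · D`. [folklore] -/
theorem seam_coeff (i j : ℕ) (hi : i ≤ m * (d (Fin.last (K₁ + 1)) - d 0)) (hj : j ≤ m * (e (Fin.last (K₂ + 1)) - e 0))
    (hseam : (e 1 - e 0) * i = (e 1 - e 0) * (∑ i, (if lam i = 0 then d (Fin.last K₁).castSucc - d 0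
        else d (Fin.last (K₁ + 1)) - d 0)) + (d (Fin.last (K₁ + 1)) - d (Fin.last K₁).castSucc) * j) :
    ((det H).coeff i).coeff j =
      (if (e 1 - e 0) ∣ j then (det (Matrix.of fun i' k' : {i : Fin m // lam i = 0} =>
          C ((Uᵀ * S (Fin.last K₁).castSucc * U) i'.1 k'.1) + X * C ((Uᵀ * T 1 * U) i'.1 k'.1))).coeff
            (j / (e 1 - e 0)) else 0) *
        ∏ i' : {i : Fin m // ¬ lam i = 0}, lam i'.1 := by
  set w : ℕ := e 1 - e 0 with hw
  set g : ℕ := d (Fin.last (K₁ + 1)) - d (Fin.last K₁).castSucc with hg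
  set n₀ : ℕ := ∑ i, (if lam i = 0 then d (Fin.last K₁).castSucc - d 0 else d (Fin.last (K₁ + 1)) - d 0) with hn₀
  set I : ℕ := m * (d (Fin.last (K₁ + 1)) - d 0) with hI
  set J : ℕ := m * (e (Fin.last (K₂ + 1)) - e 0) with hJdef
  set D : ℝ := ∏ i' : {i : Fin m // ¬ lam i = 0}, lam i'.1 with hD
  set φ : ℝ[X] := det (Matrix.of fun i' k' : {i : Fin m // lam i = 0} =>
    C ((Uᵀ * S (Fin.last K₁).castSucc * U) i'.1 k'.1) + X * C ((Uᵀ * T 1 * U) i'.1 k'.1)) with hφ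
  have hw0 : 0 < w := Nat.sub_pos_of_lt (he Fin.zero_lt_one)
  have hlim := seam_limit_F K₁ K₂ d S e T H hH U lam hd he hU hJ
  have hcrit := critical_sum_eq_of_scaling_limit (fun i j => ((det H).coeff i).coeff j) I J w g
    (w * n₀ + g * J) _ hlim
  have hk : w * n₀ + g * J = w * i + g * (J - j) := by
    have hsplit : g * J = g * j + g * (J - j) := by rw [← mul_add, Nat.add_sub_cancel' hj]
    rw [hsplit, ← add_assoc, ← hseam]
  -- the critical-line polynomial in `v` is `expand_w φ · D`
  have hR : (∑ i' ∈ range (I + 1), ∑ j' ∈ range (J + 1),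
      C (if w * n₀ + g * J = w * i' + g * (J - j') then ((det H).coeff i').coeff j' else 0) * X ^ j' : ℝ[X]) =
      expand ℝ w φ * C D := by
    apply Polynomial.funext
    intro v
    rw [eval_mul, eval_C, expand_eval, ← hcrit v, eval_finsetSum]
    refine Finset.sum_congr rfl fun i' _ => ?_
    rw [eval_finsetSum]
    refine Finset.sum_congr rfl fun j' _ => ?_
    rw [eval_mul, eval_C, eval_pow, eval_X]
    split_ifs
    · rfl
    · rw [zero_mul]
  have h1 := coeff_critical (fun i j => ((det H).coeff i).coeff j) I J w g (w * n₀ + g * J) hw0 i j hi hj hk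
  rw [hR, coeff_mul_C, coeff_expand hw0] at h1
  exact h1.symm

omit hH hd he hU hJ in
/-- `n₀ + g c = m ã`. [folklore] -/
theorem n0_add_gc (hd : StrictMono d) :
    (∑ i, (if lam i = 0 then d (Fin.last K₁).castSucc - d 0 else d (Fin.last (K₁ + 1)) - d 0)) +
      (d (Fin.last (K₁ + 1)) - d (Fin.last K₁).castSucc) * Fintype.card {i : Fin m // lam i = 0} =
      m * (d (Fin.last (K₁ + 1)) - d 0) := by
  classical
  have hlast : (Fin.last K₁).castSucc < Fin.last (K₁ + 1) := Fin.castSucc_lt_last _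
  have h1 : d 0 ≤ d (Fin.last K₁).castSucc := hd.monotone (Fin.zero_le _)
  have h2 : d (Fin.last K₁).castSucc ≤ d (Fin.last (K₁ + 1)) := (hd hlast).le
  rw [Fintype.card_subtype, Finset.card_filter, Finset.mul_sum, ← Finset.sum_add_distrib]
  have : ∀ i : Fin m, (if lam i = 0 then d (Fin.last K₁).castSucc - d 0 else d (Fin.last (K₁ + 1)) - d 0) +
      (d (Fin.last (K₁ + 1)) - d (Fin.last K₁).castSucc) * (if lam i = 0 then 1 else 0) =
      d (Fin.last (K₁ + 1)) - d 0 := by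
    intro i
    split_ifs
    · omega
    · omega
  simp only [this, Finset.sum_const, Finset.card_univ, Fintype.card_fin, smul_eq_mul]

/-- **the seam edge has at most `c + 1` monomials.** [folklore] -/
theorem card_support_seamEdge_le :
    (∑ i ∈ range (m * (d (Fin.last (K₁ + 1)) - d 0) + 1), ∑ j ∈ range (m * (e (Fin.last (K₂ + 1)) - e 0) + 1),
      C (if (e 1 - e 0) * i = (e 1 - e 0) * (∑ i, (if lam i = 0 then d (Fin.last K₁).castSucc - d 0
          else d (Fin.last (K₁ + 1)) - d 0)) + (d (Fin.last (K₁ + 1)) - d (Fin.last K₁).castSucc) * j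
        then ((det H).coeff i).coeff j else 0) * X ^ (i + j) : ℝ[X]).support.card ≤
      Fintype.card {i : Fin m // lam i = 0} + 1 := by
  classical
  set w : ℕ := e 1 - e 0 with hw
  set g : ℕ := d (Fin.last (K₁ + 1)) - d (Fin.last K₁).castSucc with hg
  set n₀ : ℕ := ∑ i, (if lam i = 0 then d (Fin.last K₁).castSucc - d 0 else d (Fin.last (K₁ + 1)) - d 0) with hn₀
  set I : ℕ := m * (d (Fin.last (K₁ + 1)) - d 0) with hI
  set J : ℕ := m * (e (Fin.last (K₂ + 1)) - e 0) with hJdef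
  set c : ℕ := Fintype.card {i : Fin m // lam i = 0} with hc
  have hw0 : 0 < w := Nat.sub_pos_of_lt (he Fin.zero_lt_one)
  have hsub : (∑ i ∈ range (I + 1), ∑ j ∈ range (J + 1),
      C (if w * i = w * n₀ + g * j then ((det H).coeff i).coeff j else 0) * X ^ (i + j) : ℝ[X]).support ⊆
      (range (c + 1)).image (fun j' => n₀ + (g + w) * j') := by
    intro n hn
    rw [mem_support_iff, coeff_family] at hn
    obtain ⟨i, hi, hne⟩ := Finset.exists_ne_zero_of_sum_ne_zero hn
    obtain ⟨j, hj, hne'⟩ := Finset.exists_ne_zero_of_sum_ne_zero hne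
    have hiI : i ≤ I := Nat.lt_succ_iff.1 (mem_range.1 hi)
    have hjJ : j ≤ J := Nat.lt_succ_iff.1 (mem_range.1 hj)
    by_cases h1 : n = i + j
    · rw [if_pos h1] at hne'
      by_cases h2 : w * i = w * n₀ + g * j
      · rw [if_pos h2] at hne'
        rw [seam_coeff K₁ K₂ d S e T H hH U lam hd he hU hJ i j hiI hjJ h2] at hne'
        by_cases hdvd : w ∣ j
        · obtain ⟨j', rfl⟩ := hdvd
          rw [if_pos (dvd_mul_right w j'), Nat.mul_div_cancel_left _ hw0] at hne'
          have hφ := left_ne_zero_of_mul hne'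
          have hj'c : j' ≤ c := (le_natDegree_of_ne_zero hφ).trans (natDegree_phi_le _ _)
          have hi_eq : i = n₀ + g * j' := by
            have : w * i = w * (n₀ + g * j') := by rw [h2]; ring
            exact Nat.eq_of_mul_eq_mul_left hw0 this
          rw [Finset.mem_image]
          exact ⟨j', mem_range.2 (Nat.lt_succ_of_le hj'c), by rw [h1, hi_eq]; ring⟩
        · rw [if_neg hdvd, zero_mul] at hne'
          exact absurd rfl hne'
      · rw [if_neg h2] at hne'
        exact absurd rfl hne'
    · rw [if_neg h1] at hne'
      exact absurd rfl hne'
  refine (Finset.card_le_card hsub).trans (Finset.card_image_le.trans ?_)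
  rw [card_range]

end Seam

end Summit.ValiantsHypothesis.ValiantsHypothesis.Theorems.LacunarySymmetroidMatrixDescartes.JunctionCeiling
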